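import Summits.ABC.StewartYu.PadicG3ParV
import Summits.ABC.StewartYu.PadicG3ParGA
import HarnessLib

/-!
# The `p`-adic Gen-3 parameter record v2 (corrected family `…V`) — part VA: the schedule in real form and the END facts

Support file (one closed form + plain theorems; no named facts). Continues `PadicG3ParV` (R1′). Twins of
`PadicG3ParGA` for the corrected scales: `8 LgV/2^s < TV s + 1`, `XsV s > 2^{s−1} g XV`,
**`4·g·XV·LgV ≤ XsV s·(TV s + 1)`**, `zerosV s ν = G·(2^{ν+1} XsV s)·(TV s + 1) ≥ 8·2^ν·(G·g·XV·LgV)` (the v2 unit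
`Z′ = G·g·XV·LgV`); END: `DV j ≤ LV/(2^{n+22}2^{lgg}) + 1 ≤ LgV/2^{n+22} + 1`, **(K1V)**, `16(n+1)LgV < (S₀NV+1)(n+2)⁴`,
`2^{n+22} N_q g XV < XsV ŜG ≤ XfinV`, `24 C_bⁿΩK/gⁿ ≤ LgV`, `D₀V ≤ g·XV·LgV/4 + 2`, **(K2V)**, **`exitAV`**.

## References
* [Nesterenko2003] Yu. V. Nesterenko, LNM 1819 (2003) — (4.3), (4.25), §5.2 (5.12)–(5.17), Lemma 5.3.
* [Yu2013] K. Yu, Acta Math. 211 (2013) — (3.5), (5.13)–(5.16), (6.12).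
-/

noncomputable section

open Finset Real

namespace Summit.ABC.StewartYu

namespace PadicG3Par

open Summit.ABC.StewartYu.RecordExitsNumeric

variable {n : ℕ} (P : PadicG3Par n)

/-! ### The schedule in real form -/

/-- `2^s g XV/2 < XsV s` (the floor plus one). [cite: Nesterenko2003, (4.3)] -/
theorem XsV_gt (s : ℕ) : (2 : ℝ) ^ s * P.g * P.XV / 2 < P.XsV s := by
  have h := Nat.lt_floor_add_one ((2 : ℝ) ^ s * P.G * P.XV / (16 * (n + 1)))
  have e : (2 : ℝ) ^ s * P.G * P.XV / (16 * (n + 1)) = 2 ^ s * P.g * P.XV / 2 := by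
    rw [P.G_eq_mul_g]; field_simp; ring
  unfold XsV; push_cast
  rw [← e]; exact h

/-- `XsV s ≤ 2^s g XV/2 + 1`. [cite: Nesterenko2003, (4.24)] -/
theorem XsV_le (s : ℕ) : (P.XsV s : ℝ) ≤ 2 ^ s * P.g * P.XV / 2 + 1 := by
  have e : (2 : ℝ) ^ s * P.G * P.XV / (16 * (n + 1)) = 2 ^ s * P.g * P.XV / 2 := by
    rw [P.G_eq_mul_g]; field_simp; ring
  have h0 : 0 ≤ (2 : ℝ) ^ s * P.G * P.XV / (16 * (n + 1)) := by
    have := P.eight_le_G; positivity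
  unfold XsV; push_cast
  rw [← e]
  linarith [Nat.floor_le h0]

/-- **`8 LgV/2^s < TV s + 1` at every level** (floor or not). [cite: Yu2013, (5.15)] -/
theorem TV_add_one_gt (s : ℕ) : (8 : ℝ) * P.LgV / 2 ^ s < P.TV s + 1 := by
  have h1 : 8 * P.LgV / 2 ^ s ≤ P.TV s := P.div_le_TV s
  have h2 := Nat.lt_div_mul_add (a := 8 * P.LgV) (b := 2 ^ s) (by positivity)
  -- `8 LgV < (8Lg/2^s + 1) · 2^s ≤ (TV s + 1) · 2^s`
  have h3 : 8 * P.LgV < (P.TV s + 1) * 2 ^ s := by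
    calc 8 * P.LgV < 8 * P.LgV / 2 ^ s * 2 ^ s + 2 ^ s := h2
      _ = (8 * P.LgV / 2 ^ s + 1) * 2 ^ s := by ring
      _ ≤ (P.TV s + 1) * 2 ^ s := Nat.mul_le_mul_right _ (by omega)
  have h3' : ((8 * P.LgV : ℕ) : ℝ) < (((P.TV s + 1) * 2 ^ s : ℕ) : ℝ) := by exact_mod_cast h3
  push_cast at h3'
  rw [div_lt_iff₀ (by positivity)]
  linarith

/-- **`4 g XV LgV ≤ XsV s · (TV s + 1)`** at every level. [cite: Nesterenko2003, (4.25)] -/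
theorem XsV_mul_ge (s : ℕ) : 4 * P.g * P.XV * P.LgV ≤ (P.XsV s : ℝ) * (P.TV s + 1) := by
  have h1 := P.XsV_gt s
  have h2 := P.TV_add_one_gt s
  have hg := (lt_of_lt_of_le one_pos P.one_le_g)
  have hX : (0 : ℝ) ≤ P.XV := by positivity
  have hL : (0 : ℝ) ≤ P.LgV := by positivity
  have h2s : (0 : ℝ) < 2 ^ s := by positivity
  have ha : 0 ≤ (2 : ℝ) ^ s * P.g * P.XV / 2 := by positivity
  have hb : 0 ≤ (8 : ℝ) * P.LgV / 2 ^ s := by positivity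
  calc 4 * P.g * P.XV * P.LgV = (2 ^ s * P.g * P.XV / 2) * (8 * P.LgV / 2 ^ s) := by
        field_simp; ring
    _ ≤ (P.XsV s : ℝ) * (P.TV s + 1) := mul_le_mul h1.le h2.le hb (by positivity)

/-- `4 XV LV ≤ XsV s · (TV s + 1)` (as `LV ≤ g LgV`). [cite: Nesterenko2003, (4.25)] -/
theorem XsV_mul_ge' (s : ℕ) : 4 * (P.XV : ℝ) * P.LV ≤ (P.XsV s : ℝ) * (P.TV s + 1) := by
  have h1 := P.XsV_mul_ge s
  have h2 := P.LV_le_g_mul_LgV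
  have hX : (0 : ℝ) ≤ P.XV := by positivity
  nlinarith

/-- The v2 Schwarz exponent at stage `(s, ν)`: gain `G` per zero at `2^{ν+1} XsV s` nodes of multiplicity
`TV s + 1`. [cite: Nesterenko2003, (4.25)] -/
def zerosV (s ν : ℕ) : ℝ := P.G * (2 ^ (ν + 1) * P.XsV s) * (P.TV s + 1)

/-- **`8 · 2^ν · (G XV LV) ≤ zerosV s ν`** at every level and stage. [cite: Nesterenko2003, (4.25)] -/
theorem zerosV_ge (s ν : ℕ) : 8 * 2 ^ ν * (P.G * P.XV * P.LV) ≤ P.zerosV s ν := by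
  unfold zerosV
  have h := P.XsV_mul_ge' s
  have hG : 0 < P.G := by linarith [P.eight_le_G]
  have h2 : (0 : ℝ) < 2 ^ ν := by positivity
  have e : P.G * (2 ^ (ν + 1) * (P.XsV s : ℝ)) * (P.TV s + 1) =
      2 * 2 ^ ν * P.G * ((P.XsV s : ℝ) * (P.TV s + 1)) := by rw [pow_succ]; ring
  rw [e]
  nlinarith [mul_pos h2 hG]

/-- **`8 · 2^ν · (G · g · XV · LgV) ≤ zerosV s ν`** (the v2 unit `Z′ = G g XV LgV`). [cite: Nesterenko2003, (4.25)] -/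
theorem zerosV_ge' (s ν : ℕ) : 8 * 2 ^ ν * (P.G * (P.g * P.XV * P.LgV)) ≤ P.zerosV s ν := by
  unfold zerosV
  have h := P.XsV_mul_ge s
  have hG : 0 < P.G := by linarith [P.eight_le_G]
  have h2 : (0 : ℝ) < 2 ^ ν := by positivity
  have e : P.G * (2 ^ (ν + 1) * (P.XsV s : ℝ)) * (P.TV s + 1) =
      2 * 2 ^ ν * P.G * ((P.XsV s : ℝ) * (P.TV s + 1)) := by rw [pow_succ]; ring
  rw [e]
  nlinarith [mul_pos h2 hG]

/-- `128 ≤ XV` (`n ≥ 1`). [folklore] -/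
theorem XV_ge_128 : (128 : ℝ) ≤ P.XV := by
  have h := P.sixtyfour_le_XV'
  have hn : (1 : ℝ) ≤ n := by exact_mod_cast P.hn
  nlinarith

/-! ### The END data -/

/-- `N_q LV/(2^{ŜG} A j) < LV/(2^{n+22} 2^{lgg})` (real; `A j > 1/2`). [cite: Nesterenko2003, §5.2 (5.17)] -/
theorem Nq_LV_div_lt (j : Fin n) :
    (P.Nq : ℝ) * P.LV / (2 ^ P.SdG * P.A j) < (P.LV : ℝ) / (2 ^ (n + 22) * 2 ^ P.lgg) := by
  have hA := P.A_pos j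
  have hA2 : (1 / 2 : ℝ) < P.A j := by have := Real.log_two_gt_d9; have := P.hA j; linarith
  have hS : (2 : ℝ) ^ (n + 23) * P.Nq * 2 ^ P.lgg < 2 ^ P.SdG := by exact_mod_cast P.lt_two_pow_SdG
  have hL : (0 : ℝ) < P.LV := by linarith [P.one_le_LV]
  have hNq : (0 : ℝ) < P.Nq := by exact_mod_cast P.hNq
  rw [div_lt_div_iff₀ (by positivity) (by positivity)]
  have e : (2 : ℝ) ^ (n + 23) = 2 ^ (n + 22) * 2 := by ring
  rw [e] at hS
  have h4 : (2 : ℝ) ^ P.SdG * (1 / 2) < 2 ^ P.SdG * P.A j := mul_lt_mul_of_pos_left hA2 (by positivity)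
  have h3 : (2 : ℝ) ^ (n + 22) * P.Nq * 2 ^ P.lgg < 2 ^ P.SdG * P.A j := by linarith
  have h5 := mul_lt_mul_of_pos_left h3 hL
  have e2 : (P.Nq : ℝ) * P.LV * (2 ^ (n + 22) * 2 ^ P.lgg) = P.LV * (2 ^ (n + 22) * P.Nq * 2 ^ P.lgg) := by ring
  rw [e2]; linarith

/-- **`DV j ≤ LV/(2^{n+22} 2^{lgg}) + 1`**. [cite: Nesterenko2003, §5.2 (5.17)] -/
theorem DV_le_DmaxV (j : Fin n) : P.DV j ≤ P.LV / (2 ^ (n + 22) * 2 ^ P.lgg) + 1 := by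
  unfold DV
  refine Nat.add_le_add_right ?_ 1
  have h := (P.Nq_LV_div_lt j).le
  calc ⌊(P.Nq : ℝ) * P.LV / (2 ^ P.SdG * P.A j)⌋₊ ≤ ⌊(P.LV : ℝ) / (2 ^ (n + 22) * 2 ^ P.lgg)⌋₊ :=
        Nat.floor_le_floor h
    _ = P.LV / (2 ^ (n + 22) * 2 ^ P.lgg) := by
        rw [show ((2 : ℝ) ^ (n + 22) * 2 ^ P.lgg) = ((2 ^ (n + 22) * 2 ^ P.lgg : ℕ) : ℝ) by push_cast; ring]
        exact Nat.floor_div_eq_div _ _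

/-- `LV/(2^{n+22} 2^{lgg}) ≤ LgV/2^{n+22}` (as `LV ≤ g LgV ≤ 2^{lgg} LgV`). [folklore] -/
theorem DmaxV_le : P.LV / (2 ^ (n + 22) * 2 ^ P.lgg) ≤ P.LgV / 2 ^ (n + 22) := by
  have hL : (0 : ℝ) ≤ P.LgV := by positivity
  have hg2 := P.g_le_two_pow_lgg
  have h1 : (P.LV : ℝ) ≤ 2 ^ P.lgg * P.LgV :=
    calc (P.LV : ℝ) ≤ P.g * P.LgV := P.LV_le_g_mul_LgV
      _ ≤ 2 ^ P.lgg * P.LgV := mul_le_mul_of_nonneg_right hg2 hL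
  have h2 : P.LV ≤ 2 ^ P.lgg * P.LgV := by exact_mod_cast h1
  have hpos : 0 < 2 ^ P.lgg := Nat.two_pow_pos _
  calc P.LV / (2 ^ (n + 22) * 2 ^ P.lgg) = P.LV / (2 ^ P.lgg * 2 ^ (n + 22)) := by rw [mul_comm]
    _ ≤ (2 ^ P.lgg * P.LgV) / (2 ^ P.lgg * 2 ^ (n + 22)) := Nat.div_le_div_right h2
    _ = P.LgV / 2 ^ (n + 22) := Nat.mul_div_mul_left _ _ hpos

/-- `4 ≤ LgV/2^{n+22}` (indeed `8`). [folklore] -/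
theorem four_le_LgV_div : 4 ≤ P.LgV / 2 ^ (n + 22) := by
  rw [Nat.le_div_iff_mul_le (by positivity)]
  calc 4 * 2 ^ (n + 22) ≤ 2 ^ (n + 25) := by
        rw [show 2 ^ (n + 25) = 8 * 2 ^ (n + 22) by ring]; omega
    _ ≤ P.LgV := P.two_pow_le_LgV

/-- **(K1V)** `2n(n+1)(LgV/2^{n+22} + 1) ≤ S₀NG + 1`. [cite: Nesterenko2003, §5.2 (5.13)–(5.14)] -/
theorem K1V : 2 * n * (n + 1) * (P.LgV / 2 ^ (n + 22) + 1) ≤ P.S0NV + 1 := by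
  have hq4 := P.four_le_LgV_div
  have hqL : P.LgV / 2 ^ (n + 22) * 2 ^ (n + 22) ≤ P.LgV := Nat.div_mul_le_self _ _
  have hpoly := mul_pow_four_le_two_pow n
  have hmain : 2 * n * (n + 1) * (P.LgV / 2 ^ (n + 22) + 1) * (n + 2) ^ 4 ≤ P.MV := by
    rw [P.MV_eq]
    generalize P.LgV / 2 ^ (n + 22) = q at hq4 hqL ⊢
    calc 2 * n * (n + 1) * (q + 1) * (n + 2) ^ 4
        ≤ 2 * n * (n + 1) * (2 * q) * (n + 2) ^ 4 := by gcongr; omega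
      _ = 4 * (n + 1) * q * (n * (n + 2) ^ 4) := by ring
      _ ≤ 4 * (n + 1) * q * 2 ^ (n + 24) := Nat.mul_le_mul_left _ hpoly
      _ = 16 * (n + 1) * (q * 2 ^ (n + 22)) := by ring
      _ ≤ 16 * (n + 1) * P.LgV := Nat.mul_le_mul_left _ hqL
  have h4 : 0 < (n + 2) ^ 4 := Nat.pow_pos (by omega)
  have h : 2 * n * (n + 1) * (P.LgV / 2 ^ (n + 22) + 1) ≤ P.S0NV := by
    show _ ≤ P.MV / (n + 2) ^ 4
    exact (Nat.le_div_iff_mul_le h4).mpr hmain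
  exact h.trans (Nat.le_succ _)

/-- (K1V) with the DV-bound: `2n(n+1)·(LV/(2^{n+22}2^{lgg}) + 1) ≤ S₀NG + 1`. [cite: Nesterenko2003, §5.2] -/
theorem K1V' : 2 * n * (n + 1) * (P.LV / (2 ^ (n + 22) * 2 ^ P.lgg) + 1) ≤ P.S0NV + 1 :=
  le_trans (Nat.mul_le_mul_left _ (Nat.add_le_add_right P.DmaxV_le 1)) P.K1V

/-- `16 (n+1) LgV < (S₀NG + 1)(n+2)⁴`. [cite: Nesterenko2003, §5.2 (5.8)] -/
theorem MV_lt_S0NV_succ_mul : 16 * (n + 1) * P.LgV < (P.S0NV + 1) * (n + 2) ^ 4 := by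
  rw [← P.MV_eq]
  unfold S0NV
  have h := Nat.lt_div_mul_add (a := P.MV) (b := (n + 2) ^ 4) (by positivity)
  calc P.MV < P.MV / (n + 2) ^ 4 * (n + 2) ^ 4 + (n + 2) ^ 4 := h
    _ = (P.MV / (n + 2) ^ 4 + 1) * (n + 2) ^ 4 := by ring

/-- **`2^{n+22} N_q g XV < XsV ŜG`** (the range bought by the depth). [cite: Yu2013, (6.12)] -/
theorem XsV_SdG_gt : (2 : ℝ) ^ (n + 22) * P.Nq * P.g * P.XV < P.XsV P.SdG := by
  have h1 := P.XsV_gt P.SdG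
  have hS : (2 : ℝ) ^ (n + 23) * P.Nq * 2 ^ P.lgg < 2 ^ P.SdG := by exact_mod_cast P.lt_two_pow_SdG
  have hl : (1 : ℝ) ≤ 2 ^ P.lgg := one_le_pow₀ (by norm_num)
  have hg := (lt_of_lt_of_le one_pos P.one_le_g)
  have hX : (0 : ℝ) < P.XV := by linarith [P.XV_ge_128]
  have hNq : (0 : ℝ) < P.Nq := by exact_mod_cast P.hNq
  have h0 : (0 : ℝ) ≤ 2 ^ (n + 23) * P.Nq := by positivity
  have h2 : (2 : ℝ) ^ (n + 23) * P.Nq ≤ 2 ^ P.SdG := by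
    have := le_mul_of_one_le_right h0 hl
    linarith
  have hgX : 0 ≤ P.g * P.XV := by positivity
  have h3 : (2 : ℝ) ^ (n + 22) * P.Nq * P.g * P.XV ≤ 2 ^ P.SdG * P.g * P.XV / 2 := by
    have := mul_le_mul_of_nonneg_right h2 hgX
    have e : (2 : ℝ) ^ (n + 23) = 2 * 2 ^ (n + 22) := by ring
    rw [e] at this
    linarith
  linarith

/-- `2^{n+22} N_q XV ≤ XsV ŜG` (natural numbers, `g ≥ 1`). [cite: Nesterenko2003, §5.2 (5.12)] -/
theorem two_pow_mul_le_XsV : 2 ^ (n + 22) * P.Nq * P.XV ≤ P.XsV P.SdG := by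
  have h := P.XsV_SdG_gt
  have hg := P.one_le_g
  have h0 : (0 : ℝ) ≤ 2 ^ (n + 22) * P.Nq * P.XV := by positivity
  have h1 : (2 : ℝ) ^ (n + 22) * P.Nq * P.XV ≤ P.XsV P.SdG := by nlinarith
  exact_mod_cast h1

/-- `XsV ŜG ≤ XfinV` (`2ⁿ ≥ n+1`). [folklore] -/
theorem XsV_le_XfinV : P.XsV P.SdG ≤ P.XfinV := by
  unfold XfinV
  rw [Nat.le_div_iff_mul_le (by positivity), mul_comm]
  exact Nat.mul_le_mul_right _ (Nat.succ_le_of_lt Nat.lt_two_pow_self)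

/-- `2^{n+22} N_q XV ≤ XfinV`. [cite: Nesterenko2003, §5.2 (5.12)] -/
theorem two_pow_mul_le_XfinV : 2 ^ (n + 22) * P.Nq * P.XV ≤ P.XfinV :=
  P.two_pow_mul_le_XsV.trans P.XsV_le_XfinV

/-- `1 ≤ XfinV`. [folklore] -/
theorem one_le_XfinV : 1 ≤ P.XfinV := by
  have h := P.two_pow_mul_le_XfinV
  have hX : 1 ≤ P.XV := le_trans (by omega) P.sixtyfour_le_XV
  have h1 : 0 < 2 ^ (n + 22) * P.Nq * P.XV :=
    Nat.mul_pos (Nat.mul_pos (Nat.two_pow_pos _) (by have := P.hNq; omega)) (by omega)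
  exact le_trans h1 h

/-- `24 C_bⁿ Ω K/gⁿ ≤ LgV` (the Siegel term, using `yloadG ≥ G`). [folklore] -/
theorem core_le_LgV : 24 * Cb ^ n * P.Ω * P.K / P.g ^ n ≤ P.LgV := by
  have h := P.mainV_le_LgV
  have hG : 0 < P.G := by linarith [P.eight_le_G]
  have hg : 0 < P.g ^ n := pow_pos (lt_of_lt_of_le one_pos P.one_le_g) n
  have hc : 0 ≤ 24 * Cb ^ n * P.Ω * P.K := by
    have := P.Ω_pos; have := P.K_pos; have : (0:ℝ) < Cb := by unfold Cb cM; positivity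
    positivity
  have hy : 1 ≤ P.yloadG / P.G := by rw [le_div_iff₀ hG, one_mul]; exact P.G_le_yloadG
  calc 24 * Cb ^ n * P.Ω * P.K / P.g ^ n = 24 * Cb ^ n * P.Ω * P.K / P.g ^ n * 1 := (mul_one _).symm
    _ ≤ 24 * Cb ^ n * P.Ω * P.K / P.g ^ n * (P.yloadG / P.G) :=
        mul_le_mul_of_nonneg_left hy (by positivity)
    _ = 24 * Cb ^ n * P.Ω * P.K * P.yloadG / (P.G * P.g ^ n) := by field_simp
    _ ≤ P.LgV := h

/-- `gⁿ = g^{n−1} · g` (`n ≥ 1`). [folklore] -/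
theorem pow_g_eq : P.g ^ n = P.g ^ (n - 1) * P.g := by
  obtain ⟨k, hk⟩ : ∃ k, n = k + 1 := ⟨n - 1, by have := P.hn; omega⟩
  subst hk
  rw [pow_succ, Nat.add_sub_cancel]

/-- **`D₀V ≤ g·XV·LgV/4 + 2`** (the excess gain and `K` cancel between `D₀V` and the multiplicity scale).
[cite: Nesterenko2003, §5.2 (5.16)] -/
theorem D0V_le' : (P.D0V : ℝ) ≤ P.g * P.XV * P.LgV / 4 + 2 := by
  unfold D0V; push_cast
  have h1 := P.L0V_lt
  have h2 := P.core_le_LgV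
  have hX : (0 : ℝ) ≤ P.XV := by positivity
  have hg0 : 0 < P.g := lt_of_lt_of_le one_pos P.one_le_g
  have hgn : 0 < P.g ^ (n - 1) := pow_pos hg0 _
  have e : 6 * (P.XV : ℝ) * Cb ^ n * P.Ω * P.K / P.g ^ (n - 1) =
      P.g * P.XV * (24 * Cb ^ n * P.Ω * P.K / P.g ^ n) / 4 := by
    rw [P.pow_g_eq]; field_simp; ring
  have h3 : 6 * (P.XV : ℝ) * Cb ^ n * P.Ω * P.K / P.g ^ (n - 1) ≤ P.g * P.XV * P.LgV / 4 := by
    rw [e]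
    have hgX : 0 ≤ P.g * P.XV := by positivity
    have := mul_le_mul_of_nonneg_left h2 hgX
    linarith
  linarith

/-- `D₀V ≤ XV·(LV + 1)/4 + 2` (box form: `g·LgV < LV + 1`). [folklore] -/
theorem D0V_le : (P.D0V : ℝ) ≤ (P.XV : ℝ) * (P.LV + 1) / 4 + 2 := by
  have h := P.D0V_le'
  have h2 := P.LV_gt
  have hX : (0 : ℝ) ≤ P.XV := by positivity
  nlinarith

/-- **(K2V)** `(n+1)² D₀G < (S₀NG + 1)(2 XfinV + 1)` — the class count AND the excess gain cancel between
`D₀G` and `LgV`; the depth supplies `N_q·2^{n+22}`. [cite: Nesterenko2003, §5.2 Lemma 5.3 (5.15)–(5.16)] -/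
theorem K2V : (n + 1) ^ 2 * P.D0V < (P.S0NV + 1) * (2 * P.XfinV + 1) := by
  have hpoly : ((n + 1 : ℕ) : ℝ) * ((n + 2 : ℕ) : ℝ) ^ 4 ≤ (2 : ℝ) ^ (n + 24) := by
    exact_mod_cast succ_mul_pow_four_le_two_pow n
  have hS : (16 : ℝ) * (n + 1) * P.LgV < (P.S0NV + 1) * ((n + 2 : ℕ) : ℝ) ^ 4 := by
    exact_mod_cast P.MV_lt_S0NV_succ_mul
  have hXs : (2 : ℝ) ^ (n + 22) * P.Nq * P.g * P.XV < P.XsV P.SdG := P.XsV_SdG_gt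
  have hXf : (P.XsV P.SdG : ℝ) ≤ P.XfinV := by exact_mod_cast P.XsV_le_XfinV
  have hNq : (1 : ℝ) ≤ P.Nq := by exact_mod_cast P.hNq
  have hg := P.one_le_g
  have hX : (128 : ℝ) ≤ P.XV := P.XV_ge_128
  have hL : (2 : ℝ) ^ (n + 25) ≤ P.LgV := by exact_mod_cast P.two_pow_le_LgV
  have h225 : (2 : ℝ) ^ 25 ≤ 2 ^ (n + 25) := pow_le_pow_right₀ (by norm_num) (by omega)
  have hD := P.D0V_le'
  have hn1 : (1 : ℝ) ≤ ((n + 1 : ℕ) : ℝ) := by exact_mod_cast Nat.succ_pos n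
  have hn2 : (0 : ℝ) < ((n + 2 : ℕ) : ℝ) ^ 4 := by positivity
  -- `gXG·LgV ≥ 128·2^25`, so `D₀G ≤ gXGLg/4 + 2 ≤ gXGLg/2`
  have hgXL : (2 : ℝ) ^ 25 ≤ P.g * P.XV * P.LgV := by nlinarith [mul_nonneg (by linarith : (0:ℝ) ≤ P.g) (by linarith : (0:ℝ) ≤ P.XV)]
  have hD' : (P.D0V : ℝ) ≤ P.g * P.XV * P.LgV / 2 := by nlinarith
  -- `2^{n+22} g XV ≤ XfinV` (drop `N_q ≥ 1`)
  have hXf' : (2 : ℝ) ^ (n + 22) * P.g * P.XV ≤ P.XfinV := by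
    have : (2 : ℝ) ^ (n + 22) * P.g * P.XV ≤ 2 ^ (n + 22) * P.Nq * P.g * P.XV := by
      have h0 : 0 ≤ (2 : ℝ) ^ (n + 22) * P.g * P.XV := by
        have : (0:ℝ) ≤ P.g := by linarith
        positivity
      nlinarith
    linarith
  have key : ((n + 1 : ℕ) : ℝ) ^ 2 * P.D0V < (P.S0NV + 1) * (2 * P.XfinV + 1) := by
    have h1 : ((n + 1 : ℕ) : ℝ) ^ 2 * P.D0V * ((n + 2 : ℕ) : ℝ) ^ 4 ≤
        ((n + 1 : ℕ) : ℝ) * (2 : ℝ) ^ (n + 24) * (P.g * P.XV * P.LgV / 2) := by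
      calc ((n + 1 : ℕ) : ℝ) ^ 2 * P.D0V * ((n + 2 : ℕ) : ℝ) ^ 4
          = ((n + 1 : ℕ) : ℝ) * (((n + 1 : ℕ) : ℝ) * ((n + 2 : ℕ) : ℝ) ^ 4) * P.D0V := by ring
        _ ≤ ((n + 1 : ℕ) : ℝ) * (2 : ℝ) ^ (n + 24) * (P.g * P.XV * P.LgV / 2) := by
            have hD0 : (0 : ℝ) ≤ P.D0V := by positivity
            gcongr
    have h2 : ((n + 1 : ℕ) : ℝ) * (2 : ℝ) ^ (n + 24) * (P.g * P.XV * P.LgV / 2) =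
        (16 * (n + 1) * P.LgV) * (2 ^ (n + 22) * P.g * P.XV) / 8 := by
      push_cast; rw [pow_add, pow_add]; ring
    have h3 : (16 * ((n : ℝ) + 1) * P.LgV) * (2 ^ (n + 22) * P.g * P.XV) <
        ((P.S0NV : ℝ) + 1) * ((n + 2 : ℕ) : ℝ) ^ 4 * P.XfinV := by
      have hpos : (0 : ℝ) < 2 ^ (n + 22) * P.g * P.XV := by
        have : (0:ℝ) < P.g := by linarith
        positivity
      calc (16 * ((n : ℝ) + 1) * P.LgV) * (2 ^ (n + 22) * P.g * P.XV)
          < ((P.S0NV : ℝ) + 1) * ((n + 2 : ℕ) : ℝ) ^ 4 * (2 ^ (n + 22) * P.g * P.XV) :=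
            mul_lt_mul_of_pos_right hS hpos
        _ ≤ ((P.S0NV : ℝ) + 1) * ((n + 2 : ℕ) : ℝ) ^ 4 * P.XfinV :=
            mul_le_mul_of_nonneg_left hXf' (by positivity)
    have h4 : ((n + 1 : ℕ) : ℝ) ^ 2 * P.D0V * ((n + 2 : ℕ) : ℝ) ^ 4 <
        (P.S0NV + 1) * (2 * P.XfinV + 1) * ((n + 2 : ℕ) : ℝ) ^ 4 := by
      have hXf0 : (0 : ℝ) ≤ P.XfinV := by positivity
      have hS0 : (0 : ℝ) ≤ (P.S0NV : ℝ) + 1 := by positivity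
      calc ((n + 1 : ℕ) : ℝ) ^ 2 * P.D0V * ((n + 2 : ℕ) : ℝ) ^ 4
          ≤ (16 * (n + 1) * P.LgV) * (2 ^ (n + 22) * P.g * P.XV) / 8 := by rw [← h2]; exact h1
        _ < ((P.S0NV : ℝ) + 1) * ((n + 2 : ℕ) : ℝ) ^ 4 * P.XfinV / 8 := by
            push_cast at h3 ⊢; linarith
        _ ≤ (P.S0NV + 1) * (2 * P.XfinV + 1) * ((n + 2 : ℕ) : ℝ) ^ 4 := by
            rw [div_le_iff₀ (by norm_num : (0:ℝ) < 8)]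
            nlinarith [mul_nonneg hS0 hXf0, mul_nonneg (mul_nonneg hS0 hXf0) hn2.le]
    exact lt_of_mul_lt_mul_right h4 hn2.le
  exact_mod_cast key

/-- **Exit A for the v2 END data** (hypothesis `hA` of `RecordAssembly.recordOdd_of_ineqs` with
`(D₀, S₀, X, Dmax) := (D₀G, S₀NG, XfinV, LgV/2^{n+22} + 1)`, and `DV j ≤ Dmax` by `DV_le_DmaxV`/`DmaxV_le`).
[cite: Nesterenko2003, §5.2 Lemma 5.3] -/
theorem exitAV : ∀ r d₀ : ℕ, r ≤ n → d₀ ≤ 1 →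
    (n + 1).factorial * 2 ^ n * P.D0V * (P.LgV / 2 ^ (n + 22) + 1) ^ r <
      Nat.choose (P.S0NV + (r + 1 - d₀)) (r + 1 - d₀) * (2 * P.XfinV + 1) *
        ((d₀ + (n - r)).factorial * 2 ^ (n - r) * P.D0V ^ d₀) :=
  exitA_of_bounds P.one_le_XfinV (by unfold D0V; omega) P.K1V P.K2V

end PadicG3Par

end Summit.ABC.StewartYu
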